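import Literature.Probability.LatticeModels.VillainSpinWave
import Literature.Probability.LatticeModels.LatticeDirichletEnergy
import HarnessLib

/-!
# The maximum of the lattice Green function is at the origin; uniform long-range order from
# `FrohlichSpencerVillainSpinWaveBound`

Two small complements to the named fact
`Literature.Probability.LatticeModels.FrohlichSpencerVillainSpinWaveBound` (`VillainSpinWave.lean`;
Dario–Wu 2020 Prop. 1.1 after Fröhlich–Spencer 1982), whose docstring promises its users the
corollary "by `0 ≤ latticeGreen x ≤ latticeGreen 0`: `⟨S_0 · S_x⟩_{μ^V_β} ≥
exp(−(1/(2β) + |r β|)·latticeGreen 0)` uniformly in `x` — long-range order `1 − O(1/β)` without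
reflection positivity", while the tree had only `latticeGreen_nonneg`:

* `latticeGreen_le_latticeGreen_zero` — **`latticeGreen x ≤ latticeGreen 0`** for `d ≥ 3` (the
  maximum principle at infinity for the function `latticeGreen`, harmonic off the origin and
  vanishing at infinity: `IsZdSubharmonicOn.le_of_forall_le_of_eventually_le`,
  `isZdHarmonicOn_latticeGreen`, `tendsto_latticeGreen_cofinite`); hence the spin-wave exponent
  `g(x) = latticeGreen 0 − latticeGreen x` lies in `[0, latticeGreen 0]`
  (`latticeGreen_zero_sub_nonneg`, `latticeGreen_zero_sub_le`);
* `FrohlichSpencerVillainSpinWaveBound.uniform_lro` — the promised corollary, as a theorem taking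
  the fact as hypothesis `(h : FrohlichSpencerVillainSpinWaveBound)`: for `d ≥ 3` there are
  `β₀ > 0` and `r` with `β r(β) → 0` such that for `β > β₀` and EVERY `x` the thermodynamic limit
  `G` of `⟨S_0·S_x⟩_{□_n,β,0}` exists and `exp(−(1/(2β) + |r(β)|)·latticeGreen 0) ≤ G`.

Theorems only; no definition and no named fact is introduced.

## References

* [DarioWu2020] P. Dario, W. Wu, arXiv:2002.02946, Proposition 1.1 (PDF pp. 4–5).
* [Lawler1991] G. F. Lawler, *Intersections of Random Walks* (1991), §1.4–1.5 (maximum principle,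
  Green function).
-/

noncomputable section

open Filter Set
open scoped Topology

namespace Literature.Probability.LatticeModels

variable {d : ℕ}

/-- **The lattice Green function is maximal at the origin**: `latticeGreen x ≤ latticeGreen 0`
(`d ≥ 3`; maximum principle at infinity for a function harmonic on `ℤ^d ∖ {0}` tending to
`0 ≤ latticeGreen 0` at infinity). [cite: Lawler1991, §1.5, p. 29] -/
theorem latticeGreen_le_latticeGreen_zero (hd : 3 ≤ d) (x : Site d) :
    latticeGreen x ≤ latticeGreen (0 : Site d) := by
  have hsub : IsZdSubharmonicOn (latticeGreen (d := d)) {0}ᶜ :=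
    (isZdHarmonicOn_latticeGreen d hd).subharmonicOn
  refine hsub.le_of_forall_le_of_eventually_le (by omega) (fun y hy => ?_) (fun ε hε => ?_) x
  · have hy0 : y = 0 := by simpa using hy
    rw [hy0]
  · have h0 := latticeGreen_nonneg d hd (0 : Site d)
    have hev : ∀ᶠ y : Site d in cofinite, latticeGreen y < ε :=
      (tendsto_latticeGreen_cofinite d hd).eventually (Iio_mem_nhds hε)
    exact hev.mono fun y hy => by linarith

/-- The spin-wave exponent is non-negative: `0 ≤ latticeGreen 0 − latticeGreen x` (`d ≥ 3`). [folklore] -/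
theorem latticeGreen_zero_sub_nonneg (hd : 3 ≤ d) (x : Site d) :
    0 ≤ latticeGreen (0 : Site d) - latticeGreen x :=
  sub_nonneg.2 (latticeGreen_le_latticeGreen_zero hd x)

/-- The spin-wave exponent is at most `latticeGreen 0`: `latticeGreen 0 − latticeGreen x ≤ latticeGreen 0`
(`d ≥ 3`, `latticeGreen ≥ 0`). [folklore] -/
theorem latticeGreen_zero_sub_le (hd : 3 ≤ d) (x : Site d) :
    latticeGreen (0 : Site d) - latticeGreen x ≤ latticeGreen (0 : Site d) :=
  sub_le_self _ (latticeGreen_nonneg d hd x)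

/-- **Uniform long-range order from the Fröhlich–Spencer spin-wave bound** — the corollary promised
to the users of the named fact in its docstring: if `FrohlichSpencerVillainSpinWaveBound` holds
then for `d ≥ 3` there are `β₀ > 0` and `r` with `β r(β) → 0` such that for every `β > β₀` and EVERY
site `x` the thermodynamic limit `G` of the zero-boundary-condition two-point functions exists and
`exp(−(1/(2β) + |r(β)|) · latticeGreen 0) ≤ G` — long-range order `1 − O(1/β)`, uniformly in `x`,
without reflection positivity (from the printed lower bound and `0 ≤ latticeGreen 0 − latticeGreen x
≤ latticeGreen 0`). [cite: DarioWu2020, Proposition 1.1 (PDF pp. 4–5)] -/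
theorem FrohlichSpencerVillainSpinWaveBound.uniform_lro (h : FrohlichSpencerVillainSpinWaveBound) :
    ∀ d : ℕ, 3 ≤ d → ∃ β₀ : ℝ, 0 < β₀ ∧ ∃ r : ℝ → ℝ,
      Tendsto (fun β : ℝ => β * r β) atTop (𝓝 0) ∧
        ∀ β : ℝ, β₀ < β → ∀ x : Site d, ∃ G : ℝ,
          Tendsto (fun n : ℕ => dirichletVillainTwoPoint (d := d) β n x) atTop (𝓝 G) ∧
            Real.exp (-(1 / (2 * β) + |r β|) * latticeGreen (0 : Site d)) ≤ G := by
  intro d hd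
  obtain ⟨β₀, hβ₀, r, hr, h'⟩ := h d hd
  refine ⟨β₀, hβ₀, r, hr, fun β hβ x => ?_⟩
  obtain ⟨c₀, C, hx⟩ := h' β hβ
  obtain ⟨G, hG, -, -, hlow⟩ := hx x
  refine ⟨G, hG, le_trans (Real.exp_le_exp.2 ?_) hlow⟩
  have hβpos : 0 < β := hβ₀.trans hβ
  have hg0 := latticeGreen_zero_sub_nonneg hd x
  have hg1 := latticeGreen_zero_sub_le hd x
  have hc : -(1 / (2 * β) + |r β|) ≤ -(1 / (2 * β)) + r β := by
    have := neg_abs_le (r β)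
    linarith
  have hcneg : -(1 / (2 * β) + |r β|) ≤ 0 := by
    have := abs_nonneg (r β)
    have : 0 < 1 / (2 * β) := by positivity
    linarith
  calc -(1 / (2 * β) + |r β|) * latticeGreen (0 : Site d)
      ≤ -(1 / (2 * β) + |r β|) * (latticeGreen (0 : Site d) - latticeGreen x) :=
        mul_le_mul_of_nonpos_left hg1 hcneg
    _ ≤ (-(1 / (2 * β)) + r β) * (latticeGreen (0 : Site d) - latticeGreen x) :=
        mul_le_mul_of_nonneg_right hc hg0
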